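import Summits.KontsevichZagierPeriods.KontsevichZagierPeriods.Theorems.HurwitzMicroSectorsNormalFormPrincipleM3EbdDualityAndSplits
import Summits.KontsevichZagierPeriods.KontsevichZagierPeriods.Theorems.HurwitzMicroSectorsNormalFormPrincipleM4NegZetaThreeBox
import Literature.NumberTheory.Transcendental.KZProductIdeal
import Literature.NumberTheory.Transcendental.KZSubcalculusInvariants

/-!
# `NormalFormPrinciple` (stmt-KontsevichZagierPeriods-3869), line `SketchIdeator1` —
# leaf `stub_boxRigidity`, layer `M4`: the first dimension-four instance (product ideal)

Pure proof file (registered sub-goal `m4_logTimesNegZetaThree`, lead seat c9; `--supports` the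
crux). The leaf `stub_boxRigidity` of the line asks that two RATIONAL integral representations on
open unit boxes with equal values be equivalent under the Kontsevich–Zagier moves. All instances
landed so far were of dimension `≤ 3`. Here is the first instance in DIMENSION FOUR:

  `[□⁴, 4/((1 + x₀)(1 + x₁x₂x₃))] ∼ [□⁴, 3/((1 + x₀)(1 − x₁x₂x₃))]`   (common value `3ζ(3)·log 2`),

obtained WITHOUT any four-dimensional chart: both sides are, up to the congruence
`KZ.of_sub_of_mem_relations_of_eqOn`, Fubini products (`KZ.IntegralRep.prod`) of the logarithm
interval `[(0,1), 1/(1+x₀)]` with the dimension-three boxes `[□³, 4/(1+xyz)]`, `[□³, 3/(1−xyz)]`,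
which are equivalent by the landed chain of moves `m4_negZetaThree_box` (two cubical charts, two
scalings, one dilation relation: `4·(3/4)ζ(3) = 3ζ(3)` read in the calculus); and the PRODUCT IDEAL
theorem of the calculus (`KZ.Equivalent.prod`, Literature `KZProductIdeal`: every elementary move,
crossed with a fixed representation, is again an elementary move) transports that chain to
dimension four. The generic entry point `m4b_of_sub_of_prod_mem_relations` (`□ᵏ × □ⁿ = □ᵏ⁺ⁿ` as a
congruence, any `k`, `n`) serves every "descent-only" equal-value pair of the dimension-four census
(`Cruxes/NormalFormPrinciple/Lines/SketchIdeator1-leaf-m3.md` §5).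
References: M. Kontsevich, D. Zagier, *Periods* (2001), §1.1–1.2 (the moves), §4.1 (products).
No definitions are introduced.
-/

noncomputable section

open MeasureTheory Set
open Literature.NumberTheory.Transcendental Literature.NumberTheory.Transcendental.KZ
open Literature.ModelTheory.ExponentialFields (IsSemialgebraic)

namespace Summit.KontsevichZagierPeriods.HurwitzMicroSectors.NormalFormPrinciple.PiBox.M3

/-- **The logarithm interval exists.** `[(0,1), 1/(1 + x₀)]` is an integral representation of
dimension `1`: a quotient of `ℚ`-polynomials whose denominator is `≥ 1` on the interval, bounded and
continuous on the compact interval `[0,1]`. [cite: KontsevichZagier2001, §1.1] -/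
theorem m4b_exists_logBox :
    ∃ L : IntegralRep 1, L.domain = {x | ∀ i, x i ∈ Set.Ioo (0:ℝ) 1} ∧
      (L.integrand = fun x => 1 / (1 + x 0)) := by
  have hB := isSemialgebraic_box 1
  have hsa : IsSemialgebraicFunOn ℚ {x : Fin 1 → ℝ | ∀ i, x i ∈ Set.Ioo (0:ℝ) 1}
      (fun x => 1 / (1 + x 0)) := by
    refine (isSemialgebraicFunOn_aeval_div_aeval hB (1 : MvPolynomial (Fin 1) ℚ)
      (1 + MvPolynomial.X 0) fun x hx => ?_).congr fun x _ => ?_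
    · simp only [map_add, map_one, MvPolynomial.aeval_X]
      have h0 := (hx 0).1
      positivity
    · simp only [map_add, map_one, MvPolynomial.aeval_X]
  have hint : IntegrableOn (fun x : Fin 1 → ℝ => 1 / (1 + x 0))
      {x : Fin 1 → ℝ | ∀ i, x i ∈ Set.Ioo (0:ℝ) 1} := by
    have hc : ContinuousOn (fun x : Fin 1 → ℝ => 1 / (1 + x 0)) (Set.Icc 0 1) :=
      continuousOn_const.div (by fun_prop) fun x hx => by
        have h0 : (0:ℝ) ≤ x 0 := hx.1 0
        positivity
    exact (hc.integrableOn_compact isCompact_Icc).mono_set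
      fun x hx => ⟨fun i => (hx i).1.le, fun i => (hx i).2.le⟩
  exact ⟨⟨_, _, hB, hsa, hint⟩, rfl, rfl⟩

/-- **The box carrier `[□³, 4/(1 + x₀x₁x₂)]` exists** (a quotient of `ℚ`-polynomials whose
denominator is `≥ 1` on the box, bounded and continuous on the compact cube `[0,1]³`).
[cite: KontsevichZagier2001, §1.1] -/
theorem m4b_exists_negZetaThreeBox :
    ∃ N : IntegralRep 3, N.domain = {x | ∀ i, x i ∈ Set.Ioo (0:ℝ) 1} ∧
      (N.integrand = fun x => 4 / (1 + x 0 * x 1 * x 2)) := by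
  have hB := isSemialgebraic_box 3
  have hsa : IsSemialgebraicFunOn ℚ {x : Fin 3 → ℝ | ∀ i, x i ∈ Set.Ioo (0:ℝ) 1}
      (fun x => 4 / (1 + x 0 * x 1 * x 2)) := by
    refine (isSemialgebraicFunOn_aeval_div_aeval hB (4 : MvPolynomial (Fin 3) ℚ)
      (1 + MvPolynomial.X 0 * MvPolynomial.X 1 * MvPolynomial.X 2) fun x hx => ?_).congr fun x _ => ?_
    · simp only [map_add, map_one, map_mul, MvPolynomial.aeval_X]
      have h0 := (hx 0).1
      have h1 := (hx 1).1
      have h2 := (hx 2).1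
      positivity
    · simp only [map_ofNat, map_add, map_one, map_mul, MvPolynomial.aeval_X]
  have hint : IntegrableOn (fun x : Fin 3 → ℝ => 4 / (1 + x 0 * x 1 * x 2))
      {x : Fin 3 → ℝ | ∀ i, x i ∈ Set.Ioo (0:ℝ) 1} := by
    have hc : ContinuousOn (fun x : Fin 3 → ℝ => 4 / (1 + x 0 * x 1 * x 2)) (Set.Icc 0 1) :=
      continuousOn_const.div (by fun_prop) fun x hx => by
        have h0 : (0:ℝ) ≤ x 0 := hx.1 0
        have h1 : (0:ℝ) ≤ x 1 := hx.1 1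
        have h2 : (0:ℝ) ≤ x 2 := hx.1 2
        positivity
    exact (hc.integrableOn_compact isCompact_Icc).mono_set
      fun x hx => ⟨fun i => (hx i).1.le, fun i => (hx i).2.le⟩
  exact ⟨⟨_, _, hB, hsa, hint⟩, rfl, rfl⟩

/-- **Boxes multiply in the product ideal (congruence form).** For representations `R` on the
open unit box `□ᵏ` and `S` on `□ⁿ`, the product `R × S` (Fubini product of the calculus,
`KZ.IntegralRep.prod`) has domain `□ᵏ⁺ⁿ` as a set and integrand `R(z|ₖ) · S(z|ⁿ)`; hence ANY
representation `M` on `□ᵏ⁺ⁿ` whose integrand agrees with that function on the box is congruent to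
`R × S`: `[M] − [R × S] ∈ KZ.relations` (`KZ.of_sub_of_mem_relations_of_eqOn`, no move needed).
This is the entry point of the "descent-only" equal-value pairs in dimension four (products of
lower-dimensional equivalences, `KZ.Equivalent.prod`). [cite: KontsevichZagier2001, §4.1] -/
theorem m4b_of_sub_of_prod_mem_relations {k n : ℕ} (R : IntegralRep k) (S : IntegralRep n)
    (hRd : R.domain = {x | ∀ i, x i ∈ Set.Ioo (0:ℝ) 1})
    (hSd : S.domain = {x | ∀ i, x i ∈ Set.Ioo (0:ℝ) 1}) (M : IntegralRep (k + n))
    (hMd : M.domain = {x | ∀ i, x i ∈ Set.Ioo (0:ℝ) 1})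
    (hMi : EqOn M.integrand (fun z => R.integrand (fun i => z (Fin.castAdd n i)) *
      S.integrand (fun j => z (Fin.natAdd k j))) M.domain) :
    of M - of (R.prod S) ∈ relations := by
  have hd : (R.prod S).domain = M.domain := by
    ext z
    rw [IntegralRep.prod_domain R S, IntegralRep.mem_prodDomain R S, hRd, hSd, hMd]
    simp only [mem_setOf_eq]
    constructor
    · rintro ⟨h1, h2⟩ i
      exact Fin.addCases (motive := fun i => z i ∈ Set.Ioo (0:ℝ) 1) (fun i => h1 i) (fun j => h2 j) i
    · intro h
      exact ⟨fun i => h _, fun j => h _⟩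
  refine of_sub_of_mem_relations_of_eqOn hd fun z hz => ?_
  rw [hMi hz, IntegralRep.prod_integrand_eq R S, IntegralRep.prodFun_apply R S]

/-- **Registered sub-goal `m4_logTimesNegZetaThree` (stmt-KontsevichZagierPeriods-3869, line
`SketchIdeator1`, layer `M4`).** The first DIMENSION-FOUR transcendence-free instance of the leaf
`stub_boxRigidity`: `[□⁴, 4/((1+x₀)(1+x₁x₂x₃))] ∼ [□⁴, 3/((1+x₀)(1−x₁x₂x₃))]` (both of value
`3ζ(3)·log 2`), obtained from the dimension-three equivalence `[□³, 4/(1+xyz)] ∼ [□³, 3/(1−xyz)]`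
(`m4_negZetaThree_box`, a chain of Kontsevich–Zagier moves) by multiplying with the logarithm
interval in the PRODUCT IDEAL of the calculus (`KZ.Equivalent.prod`: the moves of a chain, crossed
with a fixed representation, are again moves), and two congruences identifying the literal boxes with
the products. [cite: KontsevichZagier2001, §1.2 rules (1), (2); §4.1] -/
theorem m4_logTimesNegZetaThree :
    ∀ (M M' : IntegralRep 4), M.domain = {x | ∀ i, x i ∈ Set.Ioo (0:ℝ) 1} →
      EqOn M.integrand (fun x => 4 / ((1 + x 0) * (1 + x 1 * x 2 * x 3))) M.domain →
      M'.domain = {x | ∀ i, x i ∈ Set.Ioo (0:ℝ) 1} →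
      EqOn M'.integrand (fun x => 3 / ((1 + x 0) * (1 - x 1 * x 2 * x 3))) M'.domain →
      Equivalent M M' := by
  intro M M' hMd hMi hM'd hM'i
  obtain ⟨L, hLd, hLi⟩ := m4b_exists_logBox
  obtain ⟨N, hNd, hNi⟩ := m4b_exists_negZetaThreeBox
  obtain ⟨Z, hZd, hZi⟩ := ebd3_exists_zetaThreeBox
  -- `N' := 3·Z = [□³, 3/(1 − x₀x₁x₂)]`
  set N' : IntegralRep 3 := Z.constMul ((3:ℕ):ℝ) (isAlgebraic_nat 3) with hN'
  have hN'd : N'.domain = {x | ∀ i, x i ∈ Set.Ioo (0:ℝ) 1} := by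
    rw [hN', IntegralRep.domain_constMul, hZd]
  have hN'i : EqOn N'.integrand (fun x => 3 / (1 - x 0 * x 1 * x 2)) N'.domain := fun x _ => by
    rw [hN', IntegralRep.integrand_constMul, hZi]
    push_cast
    ring
  -- the dimension-three equivalence and its product with the logarithm interval
  have h3 : Equivalent N N' := m4_negZetaThree_box N N' hNd (hNi ▸ fun _ _ => rfl) hN'd hN'i
  have hL : Equivalent L L := by
    show of L - of L ∈ relations
    rw [sub_self]
    exact relations.zero_mem
  have h4 : Equivalent (L.prod N) (L.prod N') := hL.prod h3
  -- the two congruences with the literal boxes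
  have c1 : of M - of (L.prod N) ∈ relations :=
    m4b_of_sub_of_prod_mem_relations L N hLd hNd M hMd fun x hx => by
      rw [hMi hx, hLi, hNi]
      show 4 / ((1 + x 0) * (1 + x 1 * x 2 * x 3)) = 1 / (1 + x 0) * (4 / (1 + x 1 * x 2 * x 3))
      rw [div_mul_div_comm, one_mul]
  have c2 : of M' - of (L.prod N') ∈ relations :=
    m4b_of_sub_of_prod_mem_relations L N' hLd hN'd M' hM'd fun x hx => by
      rw [hM'i hx, hLi, hN', IntegralRep.integrand_constMul, hZi]
      show 3 / ((1 + x 0) * (1 - x 1 * x 2 * x 3)) =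
        1 / (1 + x 0) * (((3:ℕ):ℝ) * (1 / (1 - x 1 * x 2 * x 3)))
      push_cast
      rw [div_mul_eq_mul_div, one_mul, mul_one_div, div_div, mul_comm]
  show of M - of M' ∈ relations
  have e : of M - of M' = (of M - of (L.prod N)) + (of (L.prod N) - of (L.prod N'))
      - (of M' - of (L.prod N')) := by abel
  rw [e]
  exact relations.sub_mem (relations.add_mem c1 h4) c2

end Summit.KontsevichZagierPeriods.HurwitzMicroSectors.NormalFormPrinciple.PiBox.M3
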